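import Literature.AlgebraicGeometry.Resolution.DiffOpFiniteType
import Literature.AlgebraicGeometry.Resolution.PrincipalPartsFinite
import Literature.AlgebraicGeometry.Hironaka2017.S11CoordFree.R072bCoherentReadings
import Mathlib.RingTheory.FiniteType
import Mathlib.RingTheory.Noetherian.Basic
import HarnessLib

/-!
# [OURS · literature-class lemma for GAP-LEDGER row R67] `DiffOpOrderwiseFG`: every `Diff^{≤ m}_{A/K}` of an
# algebra of finite type over a field is a finitely generated `A`-module — and the orderwise reading `U62_5_ours`

LADDER-RESOLUTION rung M (adjudication), cell `res-hironaka`; director-resolution ruling 2026-08-26T19:47:24Z (3a)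
(«R67's P `DiffOpOrderwiseFG` = LITERATURE-class … OURS lemma: ∀ m, (diffOp K A m).FG for A of finite type over
a field K») and 19:50:49Z; desk res-dag-4 19:51:33Z (assignment to seat res-type-058); host item named by the row
lead res-adj-5 20:11:42Z: filed `--supports stmt-ResolutionOfSingularities-15522 --as helper` (the helper does
not claim to advance that crux; it is the designated landing path for literature-class OURS lemmas).

HONEST FRAMING. Nothing here is a statement of H. Hironaka's manuscript *Resolution of singularities in positive
characteristics* (2017-03-23, [Hironaka2017], lit key `paper:url-3343fd9e678b`). GAP-LEDGER row R67 concerns the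
sentence p.62 §11.2 l.50 (layout L38) «They are all global coherent `O_Z`-modules» (said of `Diff_Z`,
`Diff*_Z`, `Diff*_{Z/Z(q)}`); its ORDERWISE reading is the typed candidate `S11CoordFree.U62_5_ours` (row 072b,
p457505, OURS-labelled reading sibling [claim: Hironaka2017, status: under-review]) and the lead's (res-adj-5)
verdict FOLLOWS-MODULO-<`ResAdj5.R67.DiffOpOrderwiseFG K A := ∀ m, (diffOp K A m).FG`> (evidence file
HOME/ledger/evidence/R67/res-adj-5-R67Orderwise.lean, sha16 0fee7c4f1c5eacb3 — an evidence file, not importable;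
the proposition is therefore stated UNFOLDED below, over tree vocabulary only). THE MATHEMATICS IS THE TREE'S:
`Literature.AlgebraicGeometry.Resolution.diffOp_fg_of_isNoetherianRing` (file `Resolution/DiffOpFiniteType.lean`,
p465588, res-type-023; EGA IV₄ Prop. 16.8.6 affine case, proved there inside the commutator formalism 16.8.8 (b)):
for `A` of finite type over a Noetherian base `R`, every `Diff^{≤ m}_{A/R}` is a finitely generated `A`-module.
This file only (i) records that statement in the R67 shape for an algebra of finite type over a FIELD `K` (and over
any Noetherian commutative base), and (ii) derives the typed orderwise reading `S11CoordFree.U62_5_ours K A p e` for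
every such `A` of prime characteristic `p` and every `e` (the two intersected pieces are submodules of a finitely
generated module over the Noetherian ring `A` — the argument of res-adj-5's evidence file, re-proved here because
evidence files are not importable). No verdict word is implied by this file; verdicts live in
HOME/ledger/GAP-LEDGER.md (custodian res-dag-3). AI-produced kernel facts; the AI-review caveat of the campaign applies
to every prose remark, not to the kernel-checked statements.

CONTENTS (sorry-free, axioms standard): `R67.diffOp_fg_of_finiteType` (Noetherian base), `R67.diffOp_fg_of_finiteType_field`
(field base), `R67.diffOpOrderwiseFG_of_finiteType` (the MODULO proposition's body `∀ m, (diffOp K A m).FG`,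
verbatim), `R67.fg_inf_diffOp_of_finiteType` (any submodule met with `Diff^{≤ m}` is f.g.),
`R67.U62_5_ours_of_finiteType` (the typed orderwise reading holds for every `A` of finite type over a field, every
prime `p` with `CharP A p`, every `e`); appended: the essentially-finite-type forms `R67.diffOp_fg_of_essFiniteType'`,
`R67.diffOpOrderwiseFG_of_essFiniteType`, `R67.fg_inf_diffOp_of_essFiniteType`, `R67.U62_5_ours_of_essFiniteType`
(stalks `O_{Z,ξ}`; over res-type-080's `Resolution.diffOp_fg_of_essFiniteType`, p466091).
-/

noncomputable section

open Literature.AlgebraicGeometry.Resolution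
open Literature.AlgebraicGeometry.Hironaka2017.S11CoordFree

set_option linter.dupNamespace false -- mandated namespace of this single-conjunct summit

namespace Summit.ResolutionOfSingularities.ResolutionOfSingularities.Theorems.R67

universe u v

/-- **`Diff^{≤ m}_{A/R}` is finitely generated** for `A` of finite type over a Noetherian commutative ring `R`
(the tree's `Resolution.diffOp_fg_of_isNoetherianRing`, EGA IV₄ Prop. 16.8.6 in the affine case; restated in the
R67 shape). [folklore] -/
theorem diffOp_fg_of_finiteType (R : Type u) (A : Type v) [CommRing R] [CommRing A] [Algebra R A]
    [IsNoetherianRing R] [Algebra.FiniteType R A] (m : ℕ) : (diffOp R A m).FG :=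
  diffOp_fg_of_isNoetherianRing R m

/-- The same over a FIELD `K` (a field is Noetherian): for `A` of finite type over `K` — e.g. the affine rings
`O_Z(V)` of a scheme of finite type over `K` — every `Diff^{≤ m}_{A/K}` is a finitely generated `A`-module.
[folklore] -/
theorem diffOp_fg_of_finiteType_field (K : Type u) (A : Type v) [Field K] [CommRing A] [Algebra K A]
    [Algebra.FiniteType K A] (m : ℕ) : (diffOp K A m).FG :=
  diffOp_fg_of_finiteType K A m

/-- **R67's MODULO proposition, discharged**: the body `∀ m, (diffOp K A m).FG` of the campaign-local named
proposition `ResAdj5.R67.DiffOpOrderwiseFG K A` (res-adj-5, evidence file sha16 0fee7c4f1c5eacb3, l.34), VERBATIM,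
holds for every `A` of finite type over a Noetherian commutative base `K` (in particular over every field).
[folklore] -/
theorem diffOpOrderwiseFG_of_finiteType (K : Type u) (A : Type v) [CommRing K] [CommRing A] [Algebra K A]
    [IsNoetherianRing K] [Algebra.FiniteType K A] : ∀ m : ℕ, (diffOp K A m).FG :=
  fun m => diffOp_fg_of_finiteType K A m

/-- Any `A`-submodule of `A →ₗ[K] A` met with `Diff^{≤ m}_{A/K}` is finitely generated when `A` is of finite type
over a Noetherian `K` (`A` is then Noetherian, and a submodule of a finitely generated module over a Noetherian ring is
finitely generated — Mathlib `Submodule.FG.of_le`). [folklore] -/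
theorem fg_inf_diffOp_of_finiteType (K : Type u) (A : Type v) [CommRing K] [CommRing A] [Algebra K A]
    [IsNoetherianRing K] [Algebra.FiniteType K A] (N : Submodule A (A →ₗ[K] A)) (m : ℕ) :
    (N ⊓ diffOp K A m).FG := by
  haveI : IsNoetherianRing A := Algebra.FiniteType.isNoetherianRing K A
  exact Submodule.FG.of_le (diffOp_fg_of_finiteType K A m) inf_le_right

/-- **The typed ORDERWISE reading of p.62 l.50 holds**: for `A` of finite type over a Noetherian commutative base
`K` (in particular a field), of prime characteristic `p`, and every `e`, `S11CoordFree.U62_5_ours K A p e` — for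
every order bound `m` the `A`-modules `Diff^{≤ m}_{A/K}`, `Diff*_A ⊓ Diff^{≤ m}` and `Diff*_{A/ρ^e} ⊓ Diff^{≤ m}`
are finitely generated. (Composition of `diffOp_fg_of_finiteType` with the submodule argument of res-adj-5's
R67 evidence file; a kernel fact about the typed OURS reading, no verdict word.) [folklore] -/
theorem U62_5_ours_of_finiteType (K : Type u) (A : Type v) [CommRing K] [CommRing A] [Algebra K A]
    [IsNoetherianRing K] [Algebra.FiniteType K A] (p : ℕ) [Fact p.Prime] [CharP A p] (e : ℕ) :
    U62_5_ours K A p e :=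
  fun m => ⟨diffOp_fg_of_finiteType K A m, fg_inf_diffOp_of_finiteType K A _ m,
    fg_inf_diffOp_of_finiteType K A _ m⟩

/-- The field case of `U62_5_ours_of_finiteType`, with the instances found automatically. [folklore] -/
theorem U62_5_ours_of_finiteType_field (K : Type u) (A : Type v) [Field K] [CommRing A] [Algebra K A]
    [Algebra.FiniteType K A] (p : ℕ) [Fact p.Prime] [CharP A p] (e : ℕ) : U62_5_ours K A p e :=
  U62_5_ours_of_finiteType K A p e

/-! ### Appended 2026-08-26 (same seat): the ESSENTIALLY-finite-type form (stalks `O_{Z,ξ}`, localizations)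

res-type-080's tree lemma `Resolution.diffOp_fg_of_essFiniteType` (`Resolution/PrincipalPartsFinite.lean`,
p466091: `P^n_{A/R}` is a finite `A`-module for `A` essentially of finite type over `R`, and `Diff^{≤ n} ≅
Hom_A(P^n, A)` by the tree's EGA IV₄ 16.8.8 / 16.8.3.1 theorems) gives the same conclusion for `A` ESSENTIALLY of
finite type over `R` and Noetherian — the local rings `O_{Z,ξ}` and the rings of sections over affine opens of a
scheme of finite type over a field, localized. Recorded in the R67 shape (the director's 19:50:49Z «local/stalk
form»); the decls above are unchanged. -/

/-- **`Diff^{≤ m}_{A/R}` is finitely generated** for `A` Noetherian and ESSENTIALLY of finite type over `R` (e.g.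
`A = O_{Z,ξ}` for `Z` of finite type over a field) — the tree's `Resolution.diffOp_fg_of_essFiniteType`
(res-type-080, principal parts), restated in the R67 shape. [folklore] -/
theorem diffOp_fg_of_essFiniteType' (R : Type u) (A : Type v) [CommRing R] [CommRing A] [Algebra R A]
    [Algebra.EssFiniteType R A] [IsNoetherianRing A] (m : ℕ) : (diffOp R A m).FG :=
  diffOp_fg_of_essFiniteType R A m

/-- The body `∀ m, (diffOp K A m).FG` of `ResAdj5.R67.DiffOpOrderwiseFG K A` for `A` Noetherian and essentially
of finite type over `K` (stalk / localized form). [folklore] -/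
theorem diffOpOrderwiseFG_of_essFiniteType (K : Type u) (A : Type v) [CommRing K] [CommRing A] [Algebra K A]
    [Algebra.EssFiniteType K A] [IsNoetherianRing A] : ∀ m : ℕ, (diffOp K A m).FG :=
  fun m => diffOp_fg_of_essFiniteType K A m

/-- Any `A`-submodule of `A →ₗ[K] A` met with `Diff^{≤ m}_{A/K}` is finitely generated, for `A` Noetherian and
essentially of finite type over `K`. [folklore] -/
theorem fg_inf_diffOp_of_essFiniteType (K : Type u) (A : Type v) [CommRing K] [CommRing A] [Algebra K A]
    [Algebra.EssFiniteType K A] [IsNoetherianRing A] (N : Submodule A (A →ₗ[K] A)) (m : ℕ) :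
    (N ⊓ diffOp K A m).FG :=
  Submodule.FG.of_le (diffOp_fg_of_essFiniteType K A m) inf_le_right

/-- **The typed ORDERWISE reading `S11CoordFree.U62_5_ours K A p e` holds** for `A` Noetherian, essentially of
finite type over `K` (stalks `O_{Z,ξ}` included) and of prime characteristic `p`, every `e`. [folklore] -/
theorem U62_5_ours_of_essFiniteType (K : Type u) (A : Type v) [CommRing K] [CommRing A] [Algebra K A]
    [Algebra.EssFiniteType K A] [IsNoetherianRing A] (p : ℕ) [Fact p.Prime] [CharP A p] (e : ℕ) :
    U62_5_ours K A p e :=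
  fun m => ⟨diffOp_fg_of_essFiniteType K A m, fg_inf_diffOp_of_essFiniteType K A _ m,
    fg_inf_diffOp_of_essFiniteType K A _ m⟩

end Summit.ResolutionOfSingularities.ResolutionOfSingularities.Theorems.R67

end
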